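import Summits.AtomisticToContinuum.FouriersLaw.Theorems.OddSectorIrreversibilityCorrectorTheoryUniformH2
import Summits.AtomisticToContinuum.FouriersLaw.Theorems.VanishingNoiseTransferVanishingNoiseBoundUniformMinorization
import Literature.MathematicalPhysics.KineticTheory.VelocityFlipEmbeddedChainSteadyState

/-!
# Flip-noisy response density, step 1: Lyapunov and minorisation bounds for the resolvent and the
embedded flip chain, UNIFORM in the bath temperatures (helpers for stub `stub_responseDensityNoisy`)

Helper file `--supports stmt-AtomisticToContinuum-11975` (crux `NoiseLocality`, route
`VanishingNoiseTransfer`, line `relative-flip-energy-transfer`, stub 1b `stub_responseDensityNoisy`),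
namespace `…NoiseLocality.StubResponseDensityNoisy.Dyson`.

The flip-noisy dynamics `L + εS` of the pinned chain is realised in the tree through the chain
EMBEDDED AT THE FLIP TIMES (`VelocityFlipEmbeddedChain*.lean`): `R = R_r` the resolvent kernel of the
flip-free transition semigroup at rate `r = Nε`, `Q` the uniform single-site momentum flip,
`K = Q ∘ₖ R`; an invariant law `π` of `K` gives the weak flip steady state `π R`. The linear response
of `π R` in the bath temperatures `(T + δ/2, T - δ/2)` at `δ = 0` needs Harris bounds for `K` with
constants UNIFORM for temperatures in the window `[T/2, 2T]`. This file supplies the two inputs, for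
the Lyapunov function `e^{ϑH}`, `0 < ϑ < 1/(2T)`:

* `lintegral_exp_kernel_le_unif` — `P_t e^{ϑH} ≤ c e^{ϑH} + B` for all `t`, uniformly;
* `lintegral_exp_resolventKernel_le_unif`, `lintegral_exp_embeddedFlipKernel_le_unif` — the drift
  `R e^{ϑH} ≤ a e^{ϑH} + b`, `K e^{ϑH} ≤ a e^{ϑH} + b` with ONE `a < 1`, `b < ∞` (CEHR Thm 5.1 with a
  temperature ceiling, `pinnedChain_drift_uniform`, averaged over the exponential time as in
  `pinnedChain_lintegral_exp_hamiltonian_resolventKernel_le`);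
* `smul_le_resolventKernel_of_smul_le_kernel` — a single-time minorisation `α ν ≤ P_{t_C}` on `C`
  gives `(α Exp_r(t_C,∞)) ν' ≤ R_r` on `C` for a probability measure `ν'`;
* `resolventKernel_minorization_unif`, `embeddedFlipKernel_minorization_unif` — on every energy
  sublevel set `{H ≤ E}`, `R` and `K` are minorised with ONE constant for all temperatures in the
  window (`helper_uniformMinorization` of the sibling thesis `VanishingNoiseBound`).

No definitions.
-/

noncomputable section

open MeasureTheory ProbabilityTheory Filter Topology Set
open scoped NNReal ENNReal

namespace Summit.AtomisticToContinuum.FouriersLaw.Theorems.NoiseLocality.StubResponseDensityNoisy.Dyson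

open Literature.MathematicalPhysics.KineticTheory.HeatConduction
open Literature.Probability.Process Literature.MathematicalPhysics.KineticTheory OscillatorChain
open Summit.AtomisticToContinuum.FouriersLaw.Theorems.OddSectorIrreversibility.Corrector
open Summit.AtomisticToContinuum.FouriersLaw.Theorems.FixedLengthNoiseContinuity

variable {N : ℕ}

/-! ### A minorisation of `P_{t_C}` minorises the resolvent kernel, with an explicit constant -/

section Resolvent

variable {P : OscillatorChain} {T_L T_R : ℝ} (S : LangevinChainSemigroup P N T_L T_R)

/-- **A single-time minorisation on `C` minorises the resolvent kernel on `C`, quantitatively**: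
if `α ν ≤ P_{t_C}(z, ·)` for `z ∈ C` with `ν` a probability measure, then there is a probability
measure `ν'` with `(α · Exp_r(t_C, ∞)) ν' ≤ R_r(z, ·)` for `z ∈ C` (`ν' ∝ ∫_{t>t_C} ν P_{t-t_C} Exp_r(dt)`;
Chapman–Kolmogorov and monotonicity of `μ ↦ μ P`). -/
theorem smul_le_resolventKernel_of_smul_le_kernel {r : ℝ} (hr : 0 < r) {C : Set (PhaseSpace N)}
    {t_C : ℝ≥0} {ν : Measure (PhaseSpace N)} [IsProbabilityMeasure ν] {α : ℝ≥0∞}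
    (hν : ∀ z ∈ C, α • ν ≤ S.kernel t_C z) :
    ∃ ν' : Measure (PhaseSpace N), IsProbabilityMeasure ν' ∧
      ∀ z ∈ C, (α * expMeasure r (Ioi (t_C : ℝ))) • ν' ≤ S.resolventKernel r z := by
  -- adapted from `LangevinChainSemigroup.exists_le_resolventKernel_of_le_kernel`
  haveI := isProbabilityMeasure_expMeasure hr
  set ρ := expMeasure r with hρ
  let K' : Kernel (ℝ × PhaseSpace N) (PhaseSpace N) :=
    ⟨fun p => S.kernel (p.1 - t_C).toNNReal p.2,
      Measurable.comp (g := fun q : ℝ≥0 × PhaseSpace N => S.kernel q.1 q.2)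
        (f := fun p : ℝ × PhaseSpace N => ((p.1 - t_C).toNNReal, p.2)) S.measurable_kernel
        (by fun_prop)⟩
  have hK' : ∀ (t : ℝ) (x : PhaseSpace N), K' (t, x) = S.kernel (t - t_C).toNNReal x := fun _ _ => rfl
  let F : ℝ → Measure (PhaseSpace N) := fun t => ν.bind fun x => K' (t, x)
  have hFapply : ∀ (t : ℝ) {A : Set (PhaseSpace N)}, MeasurableSet A →
      F t A = ∫⁻ x, K' (t, x) A ∂ν := fun t A hA =>
    Measure.bind_apply hA (K'.measurable.comp measurable_prodMk_left).aemeasurable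
  have hF : Measurable F := Measure.measurable_of_measurable_coe _ fun A hA => by
    simp_rw [hFapply _ hA]
    exact (K'.measurable_coe hA).lintegral_prod_right'
  have hFuniv : ∀ t, F t univ = 1 := fun t => by
    rw [hFapply t MeasurableSet.univ]
    simp only [hK', measure_univ, lintegral_const, one_mul]
  set m : Measure (PhaseSpace N) := (ρ.restrict (Ioi (t_C : ℝ))).bind F with hm
  have hmuniv : m univ = ρ (Ioi (t_C : ℝ)) := by
    rw [hm, Measure.bind_apply MeasurableSet.univ hF.aemeasurable]
    simp_rw [hFuniv]
    rw [lintegral_const, Measure.restrict_apply MeasurableSet.univ, univ_inter, one_mul]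
  have hρ0 : ρ (Ioi (t_C : ℝ)) ≠ 0 := expMeasure_Ioi_ne_zero hr t_C.coe_nonneg
  have hρtop : ρ (Ioi (t_C : ℝ)) ≠ ⊤ := measure_ne_top _ _
  -- the bound `α m ≤ R_r(z, ·)` on `C`
  have hle : ∀ z ∈ C, α • m ≤ S.resolventKernel r z := by
    intro z hz
    refine Measure.le_iff.2 fun A hA => ?_
    have hFA : Measurable fun a => F a A := (Measure.measurable_coe hA).comp hF
    rw [Measure.smul_apply, smul_eq_mul, hm, Measure.bind_apply hA hF.aemeasurable,
      S.resolventKernel_apply hr z hA, ← lintegral_const_mul _ hFA]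
    refine (setLIntegral_mono' measurableSet_Ioi fun t ht => ?_).trans (setLIntegral_le_lintegral _ _)
    have ht' : (t_C : ℝ) ≤ t := le_of_lt ht
    have hu : t.toNNReal = t_C + (t - t_C).toNNReal := by
      conv_lhs => rw [← add_sub_cancel (t_C : ℝ) t]
      rw [Real.toNNReal_add t_C.coe_nonneg (sub_nonneg.2 ht'), Real.toNNReal_coe]
    rw [hFapply t hA, hu, S.kernel_add_apply]
    simp only [hK']
    rw [← smul_eq_mul, ← lintegral_smul_measure, ← Measure.bind_apply hA (Kernel.aemeasurable _)]
    exact Measure.le_iff.1 (bind_le_bind_of_le (hν z hz) _) A hA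
  refine ⟨(ρ (Ioi (t_C : ℝ)))⁻¹ • m, ⟨?_⟩, fun z hz => ?_⟩
  · rw [Measure.smul_apply, smul_eq_mul, hmuniv, ENNReal.inv_mul_cancel hρ0 hρtop]
  · rw [smul_smul, mul_assoc, ENNReal.mul_inv_cancel hρ0 hρtop, mul_one]
    exact hle z hz

end Resolvent

/-- Temperatures in the window `(0, 2T]` have `max T_L T_R ≤ 2T`, so `ϑ < 1/max T_L T_R`. -/
theorem theta_lt_inv_max {T ϑ T_L T_R : ℝ} (hϑT : ϑ < 1 / (2 * T)) (hL : 0 < T_L) (hL' : T_L ≤ 2 * T)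
    (hR' : T_R ≤ 2 * T) : ϑ < 1 / max T_L T_R :=
  hϑT.trans_le (one_div_le_one_div_of_le (lt_max_of_lt_left hL) (max_le hL' hR'))

section Unif

variable {ω₂ lam β γ : ℝ} (hω : 0 < ω₂) (hl : 0 < lam) (hβ : 0 < β) (hγ : 0 < γ) (hN : 0 < N)
  {T : ℝ} (hT : 0 < T) {ϑ : ℝ} (hϑ : 0 < ϑ) (hϑT : ϑ < 1 / (2 * T))
include hω hl hβ hγ hN hT hϑ hϑT

/-- **Uniform orbit bound and contracting resolvent drift.** For the pinned chain (all parameters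
`> 0`, `N ≥ 1`), `T > 0`, `0 < ϑ < 1/(2T)` and a rate `r > 0` there are `c, B < ∞`, `a < 1`, `b < ∞`
such that for ALL bath temperatures `T_L, T_R ∈ (0, 2T]`:
`P_t e^{ϑH} ≤ c e^{ϑH} + B` for all `t ≥ 0`, and `R_r e^{ϑH} ≤ a e^{ϑH} + b`. The proof of
`pinnedChain_lintegral_exp_hamiltonian_resolventKernel_le` with the uniform drift
`pinnedChain_drift_uniform` (temperature ceiling `2T`) in place of CEHR Thm 5.1 at fixed temperatures. -/
theorem lintegral_exp_kernel_resolventKernel_le_unif {r : ℝ} (hr : 0 < r) :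
    ∃ c B a b : ℝ≥0∞, c ≠ ⊤ ∧ B ≠ ⊤ ∧ a < 1 ∧ b ≠ ⊤ ∧
      ∀ (T_L T_R : ℝ) (hL : 0 < T_L) (_hL' : T_L ≤ 2 * T) (hR : 0 < T_R) (_hR' : T_R ≤ 2 * T),
        (∀ (t : ℝ≥0) (z : PhaseSpace N),
          ∫⁻ y, ENNReal.ofReal (Real.exp (ϑ * (pinnedChain ω₂ lam β γ).hamiltonian N y))
              ∂((pinnedChain ω₂ lam β γ).transitionKernel N T_L T_R t z) ≤
            c * ENNReal.ofReal (Real.exp (ϑ * (pinnedChain ω₂ lam β γ).hamiltonian N z)) + B) ∧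
        ∀ z : PhaseSpace N,
          ∫⁻ y, ENNReal.ofReal (Real.exp (ϑ * (pinnedChain ω₂ lam β γ).hamiltonian N y))
              ∂((pinnedChainSemigroup hω hl.le hβ.le hγ.le hN hL.le hR.le).resolventKernel r z) ≤
            a * ENNReal.ofReal (Real.exp (ϑ * (pinnedChain ω₂ lam β γ).hamiltonian N z)) + b := by
  -- adapted from `pinnedChain_lintegral_exp_hamiltonian_resolventKernel_le` (VelocityFlipEmbeddedChainSteadyState)
  set P := pinnedChain ω₂ lam β γ with hP
  haveI := isProbabilityMeasure_expMeasure hr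
  set ρ := expMeasure r
  have hTmax : 0 < 2 * T := by positivity
  -- the uniform growth rate of (3.4): `ϑγ(T_L + T_R) ≤ Cst`
  set Cst : ℝ := ϑ * γ * (2 * T + 2 * T) with hCst
  have hCst0 : 0 ≤ Cst := by positivity
  set ts : ℝ := 1 / (8 * (Cst + r + 1)) with hts
  have hts0 : 0 < ts := by positivity
  have hkey : (Cst + r + 1) * ts = 1 / 8 := by rw [hts]; field_simp
  have hCts : Cst * ts ≤ 1 / 8 := hkey ▸ mul_le_mul_of_nonneg_right (by linarith) hts0.le
  have hrts : r * ts ≤ 1 / 8 := hkey ▸ mul_le_mul_of_nonneg_right (by linarith) hts0.le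
  set tstar : ℝ≥0 := ⟨ts, hts0.le⟩
  have htsco : ((tstar : ℝ≥0) : ℝ) = ts := rfl
  have hts0' : (0 : ℝ≥0) < tstar := by rw [← NNReal.coe_lt_coe]; exact hts0
  set V : PhaseSpace N → ℝ≥0∞ := fun y => ENNReal.ofReal (Real.exp (ϑ * P.hamiltonian N y)) with hV
  have hVm : Measurable V := ENNReal.measurable_ofReal.comp (Real.measurable_exp.comp
    ((pinnedChain_continuous_hamiltonian ω₂ lam β γ N).measurable.const_mul _))
  -- the uniform drift at `t*` (CEHR Thm 5.1 with the ceiling `2T`)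
  obtain ⟨c₀, hc₀, hdrift⟩ := pinnedChain_drift_uniform hω hl.le hβ hγ hN hTmax hϑ hϑT tstar hts0'
  set a₀ : ℝ≥0∞ := ENNReal.ofReal (1 / 2) with ha₀
  have ha₀1 : a₀ < 1 := ENNReal.ofReal_lt_one.2 (by norm_num)
  obtain ⟨B, hBtop, hB⟩ := MarkovSemigroup.exists_fixedBound ha₀1 (ENNReal.ofReal_ne_top (r := c₀))
  set c : ℝ≥0∞ := ENNReal.ofReal (Real.exp (Cst * ts)) with hc
  refine ⟨c, B, c * ENNReal.ofReal (r * ts) + c * a₀, B + (c * ENNReal.ofReal c₀ + B),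
    ENNReal.ofReal_ne_top, hBtop, ?_, ?_, fun T_L T_R hL hL' hR hR' => ?_⟩
  · rw [hc, ha₀, ← ENNReal.ofReal_mul (Real.exp_pos _).le,
      ← ENNReal.ofReal_mul (Real.exp_pos _).le, ← ENNReal.ofReal_add (by positivity) (by positivity),
      ENNReal.ofReal_lt_one]
    have h1 : Real.exp (Cst * ts) * (1 - Cst * ts) ≤ 1 := by
      have := Real.add_one_le_exp (-(Cst * ts))
      calc Real.exp (Cst * ts) * (1 - Cst * ts)
          ≤ Real.exp (Cst * ts) * Real.exp (-(Cst * ts)) :=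
            mul_le_mul_of_nonneg_left (by linarith) (Real.exp_pos _).le
        _ = 1 := by rw [← Real.exp_add, add_neg_cancel, Real.exp_zero]
    nlinarith [Real.exp_pos (Cst * ts), mul_nonneg hCst0 hts0.le, mul_nonneg hr.le hts0.le]
  · exact ENNReal.add_ne_top.2 ⟨hBtop, ENNReal.add_ne_top.2
      ⟨ENNReal.mul_ne_top ENNReal.ofReal_ne_top ENNReal.ofReal_ne_top, hBtop⟩⟩
  set Sg := pinnedChainSemigroup hω hl.le hβ.le hγ.le hN hL.le hR.le with hSg
  have hK : ∀ (t : ℝ) (z : PhaseSpace N), Sg.timeKernel (t, z) = Sg.kernel t.toNNReal z :=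
    fun t z => rfl
  have hϑ' : ϑ < 1 / max T_L T_R := theta_lt_inv_max hϑT hL hL' hR'
  have h34 := lintegral_exp_mul_hamiltonian_pinnedChainSemigroup_le hω hl.le hβ.le hγ.le hN hL.le
    hR.le hL hR hϑ hϑ'
  -- H2 at `t*`
  have hH2 : ∀ x, ∫⁻ y, V y ∂(Sg.kernel tstar x) ≤ a₀ * V x + ENNReal.ofReal c₀ := by
    intro x
    change ∫⁻ y, V y ∂(P.transitionKernel N T_L T_R tstar x) ≤ _
    refine (hdrift T_L T_R hL hR hL' hR' x).trans (le_of_eq ?_)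
    rw [ha₀, hV, ENNReal.ofReal_add (by positivity) hc₀.le, ENNReal.ofReal_mul (by norm_num)]
  -- (3.4) on `[0, t*)`, with the uniform rate
  have hloc : ∀ u : ℝ≥0, u < tstar → ∀ x, ∫⁻ y, V y ∂(Sg.kernel u x) ≤ c * V x := by
    intro u hu x
    refine (h34 u x).trans ?_
    rw [hc, hV, ← ENNReal.ofReal_mul (by positivity)]
    refine ENNReal.ofReal_le_ofReal (mul_le_mul_of_nonneg_right (Real.exp_le_exp.2 ?_) (by positivity))
    have hu' : ((u : ℝ≥0) : ℝ) ≤ ts := by rw [← htsco]; exact_mod_cast hu.le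
    have hsum : T_L + T_R ≤ 2 * T + 2 * T := by linarith
    calc ϑ * γ * (T_L + T_R) * u ≤ Cst * u := by
          rw [hCst]
          exact mul_le_mul_of_nonneg_right (mul_le_mul_of_nonneg_left hsum (by positivity)) u.coe_nonneg
      _ ≤ Cst * ts := mul_le_mul_of_nonneg_left hu' hCst0
  have hunif : ∀ (t : ℝ≥0) x, ∫⁻ y, V y ∂(Sg.kernel t x) ≤ c * V x + B := fun t x =>
    MarkovSemigroup.lintegral_kernel_le_of_lyapunov Sg.kernel Sg.kernel_zero Sg.kernel_add hVm hts0'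
      ha₀1.le hB hH2 hloc t x
  refine ⟨fun t z => hunif t z, fun z => ?_⟩
  have h₁ : ∀ t : ℝ, ∫⁻ y, V y ∂(Sg.timeKernel (t, z)) ≤ c * V z + B := fun t => hunif t.toNNReal z
  have h₂ : ∀ t : ℝ, ts ≤ t →
      ∫⁻ y, V y ∂(Sg.timeKernel (t, z)) ≤ c * a₀ * V z + (c * ENNReal.ofReal c₀ + B) :=
    fun t ht => Sg.lintegral_kernel_le_of_tstar_le Sg.timeKernel hK hVm hH2 hunif
      (by rw [htsco]; exact ht) z
  rw [LangevinChainSemigroup.resolventKernel_eq]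
  refine (lintegral_comp_const_prod_id_le Sg.timeKernel ρ z hVm ts h₁ h₂).trans ?_
  gcongr
  exact expMeasure_Iio_le hr hts0.le

/-- **Uniform contracting drift of the embedded flip chain**: `K e^{ϑH} = R e^{ϑH} ≤ a e^{ϑH} + b`
(`H ∘ momentumFlip i = H`), the same constants for all temperatures in `(0, 2T]`. -/
theorem lintegral_exp_embeddedFlipKernel_le_unif {r : ℝ} (hr : 0 < r) :
    ∃ a b : ℝ≥0∞, a < 1 ∧ b ≠ ⊤ ∧
      ∀ (T_L T_R : ℝ) (hL : 0 < T_L) (_hL' : T_L ≤ 2 * T) (hR : 0 < T_R) (_hR' : T_R ≤ 2 * T)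
        (z : PhaseSpace N),
        (∫⁻ y, ENNReal.ofReal (Real.exp (ϑ * (pinnedChain ω₂ lam β γ).hamiltonian N y))
            ∂((pinnedChainSemigroup hω hl.le hβ.le hγ.le hN hL.le hR.le).resolventKernel r z) ≤
          a * ENNReal.ofReal (Real.exp (ϑ * (pinnedChain ω₂ lam β γ).hamiltonian N z)) + b) ∧
        ∫⁻ y, ENNReal.ofReal (Real.exp (ϑ * (pinnedChain ω₂ lam β γ).hamiltonian N y))
            ∂((pinnedChainSemigroup hω hl.le hβ.le hγ.le hN hL.le hR.le).embeddedFlipKernel r z) ≤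
          a * ENNReal.ofReal (Real.exp (ϑ * (pinnedChain ω₂ lam β γ).hamiltonian N z)) + b := by
  obtain ⟨_c, _B, a, b, _hc, _hB, ha, hb, h⟩ :=
    lintegral_exp_kernel_resolventKernel_le_unif hω hl hβ hγ hN hT hϑ hϑT hr
  refine ⟨a, b, ha, hb, fun T_L T_R hL hL' hR hR' z => ⟨(h T_L T_R hL hL' hR hR').2 z, ?_⟩⟩
  have hVm : Measurable fun y : PhaseSpace N =>
      ENNReal.ofReal (Real.exp (ϑ * (pinnedChain ω₂ lam β γ).hamiltonian N y)) :=
    ENNReal.measurable_ofReal.comp (Real.measurable_exp.comp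
      ((pinnedChain_continuous_hamiltonian ω₂ lam β γ N).measurable.const_mul _))
  rw [LangevinChainSemigroup.lintegral_embeddedFlipKernel_of_invariant _ hVm
    (fun i x => by rw [OscillatorChain.hamiltonian_momentumFlip])]
  exact (h T_L T_R hL hL' hR hR').2 z

omit hϑ hϑT in
/-- **Uniform minorisation of the resolvent kernel on energy sublevel sets**: for `r > 0` and every
level `E` there is `α > 0` such that for ALL temperatures `T_L, T_R ∈ [T/2, 2T]` some probability
measure `ν` has `α ν ≤ R_r(z, ·)` whenever `H(z) ≤ E` (uniform minorisation of `P_m` on `{H ≤ E}`,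
`helper_uniformMinorization`, then `smul_le_resolventKernel_of_smul_le_kernel`). -/
theorem resolventKernel_minorization_unif {r : ℝ} (hr : 0 < r) (E : ℝ) :
    ∃ α : ℝ≥0∞, 0 < α ∧ α < ⊤ ∧
      ∀ (T_L T_R : ℝ) (hL : T / 2 ≤ T_L) (_hL' : T_L ≤ 2 * T) (hR : T / 2 ≤ T_R) (_hR' : T_R ≤ 2 * T),
        ∃ ν : Measure (PhaseSpace N), IsProbabilityMeasure ν ∧
          ∀ z : PhaseSpace N, (pinnedChain ω₂ lam β γ).hamiltonian N z ≤ E →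
            α • ν ≤ (pinnedChainSemigroup hω hl.le hβ.le hγ.le hN ((half_pos hT).le.trans hL)
              ((half_pos hT).le.trans hR)).resolventKernel r z := by
  haveI := isProbabilityMeasure_expMeasure hr
  set cmin : ℝ := Real.sqrt (2 * γ * (T / 2)) with hcmin
  set cmax : ℝ := Real.sqrt (2 * γ * (2 * T)) with hcmax
  have hc0 : 0 < cmin := Real.sqrt_pos.2 (by positivity)
  have hcle : cmin ≤ cmax := Real.sqrt_le_sqrt (by nlinarith)
  obtain ⟨m, α₁, -, hα₁, hmin⟩ := helper_uniformMinorization ω₂ lam β γ hω hl.le hβ hγ N hN E cmin cmax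
    hc0 hcle
  have hamp : ∀ T' : ℝ, T / 2 ≤ T' → T' ≤ 2 * T →
      cmin ≤ Real.sqrt (2 * γ * T') ∧ Real.sqrt (2 * γ * T') ≤ cmax := fun T' h1 h2 =>
    ⟨Real.sqrt_le_sqrt (by nlinarith), Real.sqrt_le_sqrt (by nlinarith)⟩
  refine ⟨ENNReal.ofReal α₁ * expMeasure r (Ioi ((m : ℝ≥0) : ℝ)),
    ENNReal.mul_pos (ENNReal.ofReal_pos.2 hα₁).ne' (expMeasure_Ioi_ne_zero hr (m : ℝ≥0).coe_nonneg),
    ENNReal.mul_lt_top ENNReal.ofReal_lt_top (measure_lt_top _ _),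
    fun T_L T_R hL hL' hR hR' => ?_⟩
  obtain ⟨ν, hν, hνmin⟩ := hmin T_L T_R (hamp T_L hL hL').1 (hamp T_L hL hL').2 (hamp T_R hR hR').1
    (hamp T_R hR hR').2
  haveI := hν
  set Sg := pinnedChainSemigroup hω hl.le hβ.le hγ.le hN ((half_pos hT).le.trans hL)
    ((half_pos hT).le.trans hR) with hSg
  obtain ⟨ν', hν', hle⟩ := smul_le_resolventKernel_of_smul_le_kernel Sg hr
    (C := {z | (pinnedChain ω₂ lam β γ).hamiltonian N z ≤ E}) (t_C := (m : ℝ≥0))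
    (ν := ν) (α := ENNReal.ofReal α₁) (fun z hz => hνmin z hz)
  exact ⟨ν', hν', fun z hz => hle z hz⟩

omit hϑ hϑT in
/-- **Uniform minorisation of the embedded flip chain on energy sublevel sets**: the flip transports
the minorisation of `R_r` (`m ↦ m Q`, same mass): one `α > 0` for all temperatures in `[T/2, 2T]`. -/
theorem embeddedFlipKernel_minorization_unif {r : ℝ} (hr : 0 < r) (E : ℝ) :
    ∃ α : ℝ≥0∞, 0 < α ∧ α < ⊤ ∧
      ∀ (T_L T_R : ℝ) (hL : T / 2 ≤ T_L) (_hL' : T_L ≤ 2 * T) (hR : T / 2 ≤ T_R) (_hR' : T_R ≤ 2 * T),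
        ∃ ν : Measure (PhaseSpace N), IsProbabilityMeasure ν ∧
          ∀ z : PhaseSpace N, (pinnedChain ω₂ lam β γ).hamiltonian N z ≤ E →
            α • ν ≤ (pinnedChainSemigroup hω hl.le hβ.le hγ.le hN ((half_pos hT).le.trans hL)
              ((half_pos hT).le.trans hR)).embeddedFlipKernel r z := by
  obtain ⟨α, hα, hαtop, h⟩ := resolventKernel_minorization_unif hω hl hβ hγ hN hT hr E
  refine ⟨α, hα, hαtop, fun T_L T_R hL hL' hR hR' => ?_⟩
  obtain ⟨ν, hν, hle⟩ := h T_L T_R hL hL' hR hR'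
  haveI := hν
  refine ⟨ν.bind (flipKernel N), ⟨?_⟩, fun z hz => ?_⟩
  · rw [Measure.bind_apply MeasurableSet.univ (Kernel.aemeasurable _)]
    simp only [measure_univ, lintegral_const, one_mul]
  · have h1 := LangevinChainSemigroup.bind_flipKernel_le_embeddedFlipKernel _ (hle z hz)
    rwa [Measure.bind_smul] at h1

end Unif

/-- Registered helper sub-goal `helper_responseDensityNoisyDysonDriftMinor` of stmt-AtomisticToContinuum-11975:
the uniform drift and the uniform minorisation of the embedded flip chain on the temperature window
`[T/2, 2T]` (`lintegral_exp_embeddedFlipKernel_le_unif` ∧ `embeddedFlipKernel_minorization_unif`,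
fully quantified, notation-free one-line form). -/
theorem helper_responseDensityNoisyDysonDriftMinor : ∀ (ω₂ lam β γ : ℝ) (hω : 0 < ω₂) (hl : 0 < lam) (hβ : 0 < β) (hγ : 0 < γ) (N : ℕ) (hN : 0 < N) (T : ℝ) (hT : 0 < T) (ϑ : ℝ), 0 < ϑ → ϑ < 1 / (2 * T) → ∀ (r : ℝ), 0 < r → ∀ (E : ℝ), ∃ (a b α : ENNReal), a < 1 ∧ b ≠ ⊤ ∧ 0 < α ∧ α < ⊤ ∧ ∀ (T_L T_R : ℝ) (hL : T / 2 ≤ T_L) (_hL' : T_L ≤ 2 * T) (hR : T / 2 ≤ T_R) (_hR' : T_R ≤ 2 * T), (∀ z : Literature.MathematicalPhysics.KineticTheory.HeatConduction.PhaseSpace N, ∫⁻ y, ENNReal.ofReal (Real.exp (ϑ * (Literature.MathematicalPhysics.KineticTheory.HeatConduction.pinnedChain ω₂ lam β γ).hamiltonian N y)) ∂((Literature.MathematicalPhysics.KineticTheory.HeatConduction.pinnedChainSemigroup hω hl.le hβ.le hγ.le hN ((half_pos hT).le.trans hL) ((half_pos hT).le.trans hR)).embeddedFlipKernel r z) ≤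 a * ENNReal.ofReal (Real.exp (ϑ * (Literature.MathematicalPhysics.KineticTheory.HeatConduction.pinnedChain ω₂ lam β γ).hamiltonian N z)) + b) ∧ ∃ ν : MeasureTheory.Measure (Literature.MathematicalPhysics.KineticTheory.HeatConduction.PhaseSpace N), MeasureTheory.IsProbabilityMeasure ν ∧ ∀ z : Literature.MathematicalPhysics.KineticTheory.HeatConduction.PhaseSpace N, (Literature.MathematicalPhysics.KineticTheory.HeatConduction.pinnedChain ω₂ lam β γ).hamiltonian N z ≤ E → α • ν ≤ (Literature.MathematicalPhysics.KineticTheory.HeatConduction.pinnedChainSemigroup hω hl.le hβ.le hγ.le hN ((half_pos hT).le.trans hL) ((half_pos hT).le.trans hR)).embeddedFlipKernel r z := by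
  intro ω₂ lam β γ hω hl hβ hγ N hN T hT ϑ hϑ hϑT r hr E
  obtain ⟨a, b, ha, hb, hdrift⟩ := lintegral_exp_embeddedFlipKernel_le_unif hω hl hβ hγ hN hT hϑ hϑT hr
  obtain ⟨α, hα, hαtop, hminor⟩ := embeddedFlipKernel_minorization_unif hω hl hβ hγ hN hT hr E
  refine ⟨a, b, α, ha, hb, hα, hαtop, fun T_L T_R hL hL' hR hR' => ⟨fun z => ?_, hminor T_L T_R hL hL' hR hR'⟩⟩
  have hL0 : 0 < T_L := (half_pos hT).trans_le hL
  have hR0 : 0 < T_R := (half_pos hT).trans_le hR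
  exact (hdrift T_L T_R hL0 hL' hR0 hR' z).2

end Summit.AtomisticToContinuum.FouriersLaw.Theorems.NoiseLocality.StubResponseDensityNoisy.Dyson

end
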